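import Mathlib

/-!
# Route `BcsKacWindow`, crux `ShellMultiplicityBound` (item `stmt-HubbardSuperconductivity-1325`):
# relative cyclotomic degrees `[ℚ(ζ_n) : ℚ(ζ_n^p)]` (helper file 1/3)

For a primitive `n`-th root of unity `ζ ∈ ℂ`, a prime `p` with `n = p * n₁`, and the subfield
`F = ℚ⟮ζ ^ p⟯ = ℚ(ζ_{n₁})` of `K = ℚ⟮ζ⟯`:

* if `p ∣ n₁` then `[K : F] = φ(n)/φ(n₁) = p` and `1, ζ, …, ζ^{p-1}` are linearly independent over
  `F` (`sum_pow_mul_eq_zero_of_dvd`);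
* if `p ∤ n₁` then `[K : F] = p - 1`; with `ρ = ζ ^ n₁` (a primitive `p`-th root) the powers
  `1, ρ, …, ρ^{p-2}` are linearly independent over `F`, so `∑_{j<p} ρ^j c_j = 0` with `c_j ∈ F`
  forces all `c_j` to be equal (`sum_pow_mul_eq_zero_of_not_dvd`).

Both are proved by a dimension count (`eq_zero_of_sum_pow_mul_eq_zero`): the `ℚ`-linear map
`F^d → K`, `c ↦ ∑_{j<d} β^j c_j` is onto (every power of `ζ` is hit) and `d · [F:ℚ] = φ(n) = [K:ℚ]`,
hence it is injective. These are the two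
linear-algebra inputs of Mann's theorem on minimal vanishing sums of roots of unity
(H. B. Mann, *On linear relations between roots of unity*, Mathematika 12 (1965) 107–117, Thm 1;
J. H. Conway, A. J. Jones, Acta Arith. 30 (1976) 229–240, Thm 1 and §2), proved in the companion
file `BcsKacWindowShellMultiplicityBoundMann`.
-/

set_option linter.dupNamespace false

namespace Summit.HubbardSuperconductivity.HubbardSuperconductivity.Theorems.BcsKacWindow

open Module IntermediateField Polynomial

/-- `[ℚ(ζ) : ℚ] = φ(n)` for a primitive `n`-th root of unity `ζ ∈ ℂ` (irreducibility of the
cyclotomic polynomial). -/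
theorem finrank_adjoin_primitiveRoot {n : ℕ} {ζ : ℂ} (hζ : IsPrimitiveRoot ζ n) (hn : 0 < n) :
    finrank ℚ ℚ⟮ζ⟯ = n.totient := by
  rw [IntermediateField.adjoin.finrank ((hζ.isIntegral hn).tower_top),
    ← cyclotomic_eq_minpoly_rat hζ hn, natDegree_cyclotomic]

/-- Powers of a primitive `n`-th root agree when the exponents agree mod `n`. -/
theorem pow_eq_pow_of_modEq {n : ℕ} {ζ : ℂ} (hζ : IsPrimitiveRoot ζ n) {a b : ℕ}
    (h : a ≡ b [MOD n]) : ζ ^ a = ζ ^ b := by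
  wlog hab : a ≤ b generalizing a b
  · exact (this h.symm (le_of_not_ge hab)).symm
  obtain ⟨c, rfl⟩ := Nat.exists_eq_add_of_le hab
  have hc : n ∣ c := by
    have := (Nat.modEq_iff_dvd' (Nat.le_add_right a c)).mp h
    simpa using this
  rw [pow_add, (hζ.pow_eq_one_iff_dvd c).mpr hc, mul_one]

/-- **Dimension count.** Let `F ≤ K = ℚ⟮ζ⟯` be a subfield and `β ∈ K`. If every power `ζ^e` is
of the form `∑_{j<d} β^j c_j` with `c_j ∈ F` (so the `ℚ`-linear map `F^d → K`, `c ↦ ∑ β^j c_j` is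
onto, `K` being spanned by the powers of `ζ`) and `d · [F:ℚ] = φ(n) = [K:ℚ]`, then that map is
injective: a vanishing combination `∑_{j<d} β^j c_j = 0` with `c_j ∈ F` has all `c_j = 0`. -/
theorem eq_zero_of_sum_pow_mul_eq_zero {n : ℕ} {ζ : ℂ} (hζ : IsPrimitiveRoot ζ n) (hn : 0 < n)
    (F : IntermediateField ℚ ℂ) (hF : F ≤ ℚ⟮ζ⟯) [FiniteDimensional ℚ F] (β : ℂ) (hβ : β ∈ ℚ⟮ζ⟯)
    (d : ℕ) (hdim : d * finrank ℚ F = n.totient)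
    (hspan : ∀ e : ℕ, ∃ c : Fin d → F, ζ ^ e = ∑ j : Fin d, β ^ (j : ℕ) * (c j : ℂ))
    (c : ℕ → ℂ) (hc : ∀ j < d, c j ∈ F) (hsum : ∑ j ∈ Finset.range d, β ^ j * c j = 0) :
    ∀ j < d, c j = 0 := by
  haveI : FiniteDimensional ℚ ℚ⟮ζ⟯ := adjoin.finiteDimensional ((hζ.isIntegral hn).tower_top)
  -- the linear map `Ψ c = ∑ β^j c_j`
  let Ψ : (Fin d → F) →ₗ[ℚ] ℚ⟮ζ⟯ :=
    { toFun := fun c => ⟨∑ j : Fin d, β ^ (j : ℕ) * (c j : ℂ),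
        sum_mem fun j _ => mul_mem (pow_mem hβ _) (hF (c j).2)⟩
      map_add' := fun c c' => by
        apply Subtype.ext
        simp only [Pi.add_apply, AddMemClass.coe_add, mul_add, Finset.sum_add_distrib]
      map_smul' := fun r c => by
        apply Subtype.ext
        simp only [Pi.smul_apply, IntermediateField.coe_smul, RingHom.id_apply, Finset.smul_sum,
          mul_smul_comm] }
  have hΨ : ∀ c : Fin d → F, (Ψ c : ℂ) = ∑ j : Fin d, β ^ (j : ℕ) * (c j : ℂ) := fun c => rfl
  -- `Ψ` is onto: `K` is spanned by the powers of `ζ`, each of which is hit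
  have hsurj : Function.Surjective Ψ := by
    intro z
    have hz : (z : ℂ) ∈ Algebra.adjoin ℚ {ζ} := by
      rw [← adjoin_simple_toSubalgebra_of_isAlgebraic ((hζ.isIntegral hn).tower_top.isAlgebraic)]
      exact z.2
    rw [Algebra.adjoin_singleton_eq_range_aeval] at hz
    obtain ⟨q, hq⟩ := hz
    choose c hc using hspan
    refine ⟨∑ i ∈ Finset.range (q.natDegree + 1), q.coeff i • c i, ?_⟩
    apply Subtype.ext
    rw [map_sum]
    change ((∑ i ∈ Finset.range (q.natDegree + 1), Ψ (q.coeff i • c i) : ℚ⟮ζ⟯) : ℂ) = (z : ℂ)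
    rw [← hq, AlgHom.toRingHom_eq_coe, RingHom.coe_coe, aeval_eq_sum_range]
    push_cast
    refine Finset.sum_congr rfl fun i _ => ?_
    rw [map_smul, IntermediateField.coe_smul, hΨ, ← hc i]
  -- hence injective, by the dimension count
  have hinj : Function.Injective Ψ := by
    rw [LinearMap.injective_iff_surjective_of_finrank_eq_finrank]
    · exact hsurj
    · rw [Module.finrank_pi_fintype, Finset.sum_const, Finset.card_univ, Fintype.card_fin,
        smul_eq_mul, hdim, finrank_adjoin_primitiveRoot hζ hn]
  set c' : Fin d → F := fun j => ⟨c j, hc j j.2⟩ with hc'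
  have h0 : Ψ c' = 0 := by
    apply Subtype.ext
    rw [hΨ]
    change ∑ j : Fin d, β ^ (j : ℕ) * c j = ((0 : ℚ⟮ζ⟯) : ℂ)
    rw [ZeroMemClass.coe_zero, ← hsum, ← Fin.sum_univ_eq_sum_range (fun j => β ^ j * c j) d]
  have hc0 : c' = 0 := hinj (h0.trans (map_zero _).symm)
  intro j hj
  have := congr_fun hc0 ⟨j, hj⟩
  rw [hc'] at this
  exact congr_arg Subtype.val this

section dvd

/-! ### Case `p ∣ n₁`: the powers `1, ζ, …, ζ^{p-1}` are independent over `ℚ(ζ^p)` -/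

/-- **Case `p² ∣ n`.** Let `ζ` be a primitive `n`-th root of unity, `n = p * n₁` with `p` prime and
`p ∣ n₁`. If `∑_{j<p} ζ^j c_j = 0` with all `c_j ∈ ℚ(ζ^p)`, then all `c_j = 0`. -/
theorem sum_pow_mul_eq_zero_of_dvd {n p n₁ : ℕ} {ζ : ℂ} (hζ : IsPrimitiveRoot ζ n) (hn : 0 < n)
    (hp : p.Prime) (hnp : n = p * n₁) (hpn₁ : p ∣ n₁)
    (c : ℕ → ℂ) (hc : ∀ j < p, c j ∈ ℚ⟮ζ ^ p⟯) (hsum : ∑ j ∈ Finset.range p, ζ ^ j * c j = 0) :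
    ∀ j < p, c j = 0 := by
  have hn₁ : 0 < n₁ := Nat.pos_of_ne_zero fun h => by simp [hnp, h] at hn
  have hη : IsPrimitiveRoot (ζ ^ p) n₁ := by
    have := hζ.pow_of_dvd hp.ne_zero (hnp ▸ dvd_mul_right p n₁)
    rwa [hnp, Nat.mul_div_cancel_left _ hp.pos] at this
  haveI : FiniteDimensional ℚ ℚ⟮ζ ^ p⟯ := adjoin.finiteDimensional ((hη.isIntegral hn₁).tower_top)
  have hF : ℚ⟮ζ ^ p⟯ ≤ ℚ⟮ζ⟯ :=
    adjoin_simple_le_iff.mpr (pow_mem (mem_adjoin_simple_self ℚ ζ) _)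
  have hβ : ζ ∈ ℚ⟮ζ⟯ := mem_adjoin_simple_self ℚ ζ
  refine eq_zero_of_sum_pow_mul_eq_zero hζ hn ℚ⟮ζ ^ p⟯ hF ζ hβ p ?_ ?_ c hc hsum
  · rw [finrank_adjoin_primitiveRoot hη hn₁, hnp, Nat.totient_mul_of_prime_of_dvd hp hpn₁]
  · intro e
    refine ⟨Pi.single (⟨e % p, Nat.mod_lt e hp.pos⟩ : Fin p)
      ⟨(ζ ^ p) ^ (e / p), pow_mem (mem_adjoin_simple_self ℚ (ζ ^ p)) _⟩, ?_⟩
    rw [Finset.sum_eq_single (⟨e % p, Nat.mod_lt e hp.pos⟩ : Fin p)]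
    · simp only [Pi.single_eq_same]
      rw [← pow_mul, ← pow_add, Nat.mod_add_div e p]
    · intro j _ hj
      rw [Pi.single_eq_of_ne hj]
      simp
    · simp

end dvd

section notdvd

/-! ### Case `p ∤ n₁`: the powers `1, ρ, …, ρ^{p-2}` of `ρ = ζ^{n₁}` are independent
over `ℚ(ζ^p)` -/

/-- Bezout-type exponents from Euler's theorem: if `p` is prime and `p ∤ n₁` (`0 < n₁`) there are
natural numbers `A, B` with `A * p ≡ 1 [MOD n₁]`, `B * n₁ ≡ 1 [MOD p]`. -/
theorem exists_inverse_exponents {p n₁ : ℕ} (hp : p.Prime) (hpn₁ : ¬p ∣ n₁) (hn₁ : 0 < n₁) :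
    ∃ A B : ℕ, A * p ≡ 1 [MOD n₁] ∧ B * n₁ ≡ 1 [MOD p] := by
  have hcop : Nat.Coprime p n₁ := (Nat.Prime.coprime_iff_not_dvd hp).mpr hpn₁
  refine ⟨p ^ (n₁.totient - 1), n₁ ^ (p.totient - 1), ?_, ?_⟩
  · have h := Nat.ModEq.pow_totient hcop
    rwa [← Nat.sub_add_cancel (Nat.totient_pos.mpr hn₁), pow_succ] at h
  · have h := Nat.ModEq.pow_totient hcop.symm
    rwa [← Nat.sub_add_cancel (Nat.totient_pos.mpr hp.pos), pow_succ] at h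

/-- CRT decomposition of the powers of `ζ`: with `A, B` as in `exists_inverse_exponents`,
`ζ^e = ρ^{eB} η^{eA}` where `ρ = ζ^{n₁}`, `η = ζ^p`. -/
theorem pow_eq_rho_pow_mul_eta_pow {n p n₁ : ℕ} {ζ : ℂ} (hζ : IsPrimitiveRoot ζ n)
    (hp : p.Prime) (hnp : n = p * n₁) (hpn₁ : ¬p ∣ n₁) {A B : ℕ}
    (hA : A * p ≡ 1 [MOD n₁]) (hB : B * n₁ ≡ 1 [MOD p]) (e : ℕ) :
    ζ ^ e = (ζ ^ n₁) ^ (e * B) * (ζ ^ p) ^ (e * A) := by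
  have hcop : Nat.Coprime p n₁ := (Nat.Prime.coprime_iff_not_dvd hp).mpr hpn₁
  rw [← pow_mul, ← pow_mul, ← pow_add]
  apply pow_eq_pow_of_modEq hζ
  rw [hnp]
  refine (Nat.modEq_and_modEq_iff_modEq_mul hcop).mp ⟨?_, ?_⟩
  · -- mod p: `n₁ * (e * B) ≡ e`, `p * (e * A) ≡ 0`
    have h1 : n₁ * (e * B) ≡ e [MOD p] := by
      have : n₁ * (e * B) = e * (B * n₁) := by ring
      rw [this]
      simpa using hB.mul_left e
    have h2 : p * (e * A) ≡ 0 [MOD p] := (Nat.modEq_zero_iff_dvd).mpr (dvd_mul_right _ _)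
    simpa using (h1.add h2).symm
  · have h1 : n₁ * (e * B) ≡ 0 [MOD n₁] := (Nat.modEq_zero_iff_dvd).mpr (dvd_mul_right _ _)
    have h2 : p * (e * A) ≡ e [MOD n₁] := by
      have : p * (e * A) = e * (A * p) := by ring
      rw [this]
      simpa using hA.mul_left e
    simpa using (h1.add h2).symm

/-- **Case `p ∥ n`.** Let `ζ` be a primitive `n`-th root of unity, `n = p * n₁` with `p` prime and
`p ∤ n₁`, and `ρ = ζ^{n₁}`. If `∑_{j<p-1} ρ^j c_j = 0` with all `c_j ∈ ℚ(ζ^p)`, then all `c_j = 0`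
(`j < p - 1`). -/
theorem sum_rho_pow_mul_eq_zero {n p n₁ : ℕ} {ζ : ℂ} (hζ : IsPrimitiveRoot ζ n) (hn : 0 < n)
    (hp : p.Prime) (hnp : n = p * n₁) (hpn₁ : ¬p ∣ n₁)
    (c : ℕ → ℂ) (hc : ∀ j < p - 1, c j ∈ ℚ⟮ζ ^ p⟯)
    (hsum : ∑ j ∈ Finset.range (p - 1), (ζ ^ n₁) ^ j * c j = 0) :
    ∀ j < p - 1, c j = 0 := by
  have hn₁ : 0 < n₁ := Nat.pos_of_ne_zero fun h => by simp [hnp, h] at hn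
  have hη : IsPrimitiveRoot (ζ ^ p) n₁ := by
    have := hζ.pow_of_dvd hp.ne_zero (hnp ▸ dvd_mul_right p n₁)
    rwa [hnp, Nat.mul_div_cancel_left _ hp.pos] at this
  have hρ : IsPrimitiveRoot (ζ ^ n₁) p := by
    have := hζ.pow_of_dvd hn₁.ne' (hnp ▸ dvd_mul_left n₁ p)
    rwa [hnp, Nat.mul_div_cancel _ hn₁] at this
  haveI : FiniteDimensional ℚ ℚ⟮ζ ^ p⟯ := adjoin.finiteDimensional ((hη.isIntegral hn₁).tower_top)
  have hF : ℚ⟮ζ ^ p⟯ ≤ ℚ⟮ζ⟯ :=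
    adjoin_simple_le_iff.mpr (pow_mem (mem_adjoin_simple_self ℚ ζ) _)
  have hβ : ζ ^ n₁ ∈ ℚ⟮ζ⟯ := pow_mem (mem_adjoin_simple_self ℚ ζ) _
  obtain ⟨A, B, hA, hB⟩ := exists_inverse_exponents hp hpn₁ hn₁
  -- the geometric sum `∑_{j<p} ρ^j = 0`, split off the last term
  have hgeom : (ζ ^ n₁) ^ (p - 1) = -∑ j ∈ Finset.range (p - 1), (ζ ^ n₁) ^ j := by
    have h := hρ.geom_sum_eq_zero hp.one_lt
    rw [← Nat.sub_add_cancel hp.one_lt.le, Finset.sum_range_succ] at h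
    linear_combination h
  refine eq_zero_of_sum_pow_mul_eq_zero hζ hn ℚ⟮ζ ^ p⟯ hF (ζ ^ n₁) hβ (p - 1) ?_ ?_ c hc hsum
  · rw [finrank_adjoin_primitiveRoot hη hn₁, hnp, Nat.totient_mul_of_prime_of_not_dvd hp hpn₁]
  · intro e
    have he := pow_eq_rho_pow_mul_eta_pow hζ hp hnp hpn₁ hA hB e
    -- reduce the `ρ`-exponent mod `p`
    have hred : (ζ ^ n₁) ^ (e * B) = (ζ ^ n₁) ^ (e * B % p) := by
      conv_lhs => rw [← Nat.mod_add_div (e * B) p, pow_add, pow_mul, hρ.pow_eq_one, one_pow,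
        mul_one]
    rw [hred] at he
    have hlt : e * B % p < p := Nat.mod_lt _ hp.pos
    have hηmem : (ζ ^ p) ^ (e * A) ∈ ℚ⟮ζ ^ p⟯ := pow_mem (mem_adjoin_simple_self ℚ (ζ ^ p)) _
    by_cases hlast : e * B % p = p - 1
    · -- top power: use the geometric sum
      refine ⟨fun _ => ⟨-(ζ ^ p) ^ (e * A), neg_mem hηmem⟩, ?_⟩
      simp only []
      rw [he, hlast, hgeom, ← Finset.sum_neg_distrib, Finset.sum_mul,
        ← Fin.sum_univ_eq_sum_range (fun j => -(ζ ^ n₁) ^ j * (ζ ^ p) ^ (e * A)) (p - 1)]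
      refine Finset.sum_congr rfl fun j _ => ?_
      ring
    · have hlt' : e * B % p < p - 1 := by omega
      refine ⟨Pi.single (⟨e * B % p, hlt'⟩ : Fin (p - 1)) ⟨(ζ ^ p) ^ (e * A), hηmem⟩, ?_⟩
      rw [Finset.sum_eq_single (⟨e * B % p, hlt'⟩ : Fin (p - 1))]
      · simp only [Pi.single_eq_same]
        exact he
      · intro j _ hj
        rw [Pi.single_eq_of_ne hj]
        simp
      · simp

/-- **Case `p ∥ n`, all-equal form.** With the notation of `sum_rho_pow_mul_eq_zero`: if
`∑_{j<p} ρ^j c_j = 0` with all `c_j ∈ ℚ(ζ^p)`, then `c_j = c_{p-1}` for every `j < p` (the only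
linear relation among `1, ρ, …, ρ^{p-1}` over `ℚ(ζ^p)` is `1 + ρ + ⋯ + ρ^{p-1} = 0`). -/
theorem sum_pow_mul_eq_zero_of_not_dvd {n p n₁ : ℕ} {ζ : ℂ} (hζ : IsPrimitiveRoot ζ n) (hn : 0 < n)
    (hp : p.Prime) (hnp : n = p * n₁) (hpn₁ : ¬p ∣ n₁)
    (c : ℕ → ℂ) (hc : ∀ j < p, c j ∈ ℚ⟮ζ ^ p⟯)
    (hsum : ∑ j ∈ Finset.range p, (ζ ^ n₁) ^ j * c j = 0) :
    ∀ j < p, c j = c (p - 1) := by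
  have hn₁ : 0 < n₁ := Nat.pos_of_ne_zero fun h => by simp [hnp, h] at hn
  have hρ : IsPrimitiveRoot (ζ ^ n₁) p := by
    have := hζ.pow_of_dvd hn₁.ne' (hnp ▸ dvd_mul_left n₁ p)
    rwa [hnp, Nat.mul_div_cancel _ hn₁] at this
  have hgeom : (ζ ^ n₁) ^ (p - 1) = -∑ j ∈ Finset.range (p - 1), (ζ ^ n₁) ^ j := by
    have h := hρ.geom_sum_eq_zero hp.one_lt
    rw [← Nat.sub_add_cancel hp.one_lt.le, Finset.sum_range_succ] at h
    linear_combination h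
  -- subtract `c (p-1)` times the geometric relation
  have hsum' : ∑ j ∈ Finset.range (p - 1), (ζ ^ n₁) ^ j * (c j - c (p - 1)) = 0 := by
    have h := hsum
    rw [← Nat.sub_add_cancel hp.one_lt.le, Finset.sum_range_succ] at h
    rw [hgeom, ← Finset.sum_neg_distrib, Finset.sum_mul, ← Finset.sum_add_distrib] at h
    rw [← h]
    refine Finset.sum_congr rfl fun j _ => ?_
    ring
  have hzero := sum_rho_pow_mul_eq_zero hζ hn hp hnp hpn₁ (fun j => c j - c (p - 1))
    (fun j hj => sub_mem (hc j (by omega)) (hc (p - 1) (Nat.sub_lt hp.pos one_pos))) hsum'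
  intro j hj
  by_cases hj' : j = p - 1
  · rw [hj']
  · exact sub_eq_zero.mp (hzero j (by omega))

end notdvd

end Summit.HubbardSuperconductivity.HubbardSuperconductivity.Theorems.BcsKacWindow
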